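import Mathlib
import Summits.Ventures.PercRepro2.Defs
import Summits.Ventures.PercRepro2.Harris

/-!
# Decision trees and the tree-observation lemma (TREE-PA) (blind cell PercRepro2, mine-a g40;
MINE-A.md §95.2)

A finite *decision tree* over the edge type `E` is a leaf (stop) or a query of an edge `e` with a
continuation for each answer (`t0`: `e` closed, `t1`: `e` open) — adaptive edge revealment with an
arbitrary stopping rule, the object of the exploration lens.  With the pinning API of `Defs.lean`,
the conditional law given the answers along a branch is the product law with those edges pinned, so
a *leaf functional* of the pinned weight vector `q ↦ φ q` is summed along the tree by

  `leafSum φ t p = Σ_leaves P(leaf) · φ(p pinned along the leaf)`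

(`leafSum`), and `leafSum (fun q => expect q F) t p = expect p F` is the tower identity
(`leafSum_expect`).  The *tree covariance*

  `treeCov F G t p = Σ_{internal nodes h} P(h) · p_h (1 − p_h) · (f(h1) − f(h0)) · (g(h1) − g(h0))`,

`f(h′) = E[F ∣ h′]`, is the martingale decomposition of the covariance of the conditional means:

* `cov_eq_leafSum_add_treeCov` — `Cov_p(F, G) = Σ_leaves P(leaf) Cov_leaf(F, G) + treeCov F G t p`
  (the law of total covariance along the tree, an exact identity for every tree);
* `condMeanCov_eq_treeCov` — `Σ_leaves P(leaf) (E[F∣leaf] − E F)(E[G∣leaf] − E G) = treeCov F G t p`;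
* **`treeCov_nonneg` / `condMeanCov_nonneg` (TREE-PA)** — for admissible weights and monotone
  `F, G`, every node term is a product of `p_h (1 − p_h) ≥ 0` with two Harris differences
  `E_{p[e↦1]} F − E_{p[e↦0]} F ≥ 0`: the conditional means of monotone observables given the output
  of ANY decision tree are positively correlated;
* `leafSum_cov_le_cov` — the covariance dominates the average leaf-conditional covariance.

Paper consequences (MINE-A.md §95.2, not formalised here): for a cluster functional of a root `r`
the leaf mean of the full exploration of the cluster of a vertex `x` depends on `C_x` alone, so
`Cov(E[F ∣ C_x], E[G ∣ C_x]) ≥ 0`; and the exact identity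
`(CR) ⟺ treeCov(exploration of C(X)) ≥ P(R) · Cov(fibre means ∣ R)`.  No definition beyond
`DTree`, `leafSum`, `treeCov`, `condMeanCov`; one seat.
-/

namespace Summit.Ventures.PercRepro2

/-- A finite decision tree over the edge type `E`: a leaf (stop), or the query of an edge `e`
with the continuation `t0` if `e` is closed and `t1` if `e` is open. -/
inductive DTree (E : Type*) where
  /-- stop -/
  | leaf : DTree E
  /-- query `e`; continue with `t0` if closed, `t1` if open -/
  | node (e : E) (t0 t1 : DTree E) : DTree E

namespace DTree

variable {E : Type*} [Fintype E] [DecidableEq E] {R : Type*} [CommRing R]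

/-- The leaf-sum of a functional `φ` of the pinned weight vector along the tree `t` started at the
weights `p`: at a leaf `φ p`; at a node `e`, the Bernoulli mixture `p e · (…[e↦1]) + (1 − p e) · (…[e↦0])`
of the two continuations.  `leafSum φ t p = Σ_leaves P(leaf) · φ(p pinned along the leaf)`. -/
def leafSum (φ : (E → R) → R) : DTree E → (E → R) → R
  | leaf, p => φ p
  | node e t0 t1, p => p e * leafSum φ t1 (Function.update p e 1)
      + (1 - p e) * leafSum φ t0 (Function.update p e 0)

/-- The tree covariance of `F, G` along `t` from `p`: the sum over the internal nodes of
`P(h) · p_h (1 − p_h) · (E_{p_h[e↦1]} F − E_{p_h[e↦0]} F) · (E_{p_h[e↦1]} G − E_{p_h[e↦0]} G)`. -/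
def treeCov (F G : Config E → R) : DTree E → (E → R) → R
  | leaf, _ => 0
  | node e t0 t1, p => p e * treeCov F G t1 (Function.update p e 1)
      + (1 - p e) * treeCov F G t0 (Function.update p e 0)
      + p e * (1 - p e) * (expect (Function.update p e 1) F - expect (Function.update p e 0) F)
        * (expect (Function.update p e 1) G - expect (Function.update p e 0) G)

/-- The covariance of the leaf-conditional means: `Σ_leaves P(leaf) (E[F∣leaf] − E_p F)(E[G∣leaf] − E_p G)`. -/
def condMeanCov (F G : Config E → R) (t : DTree E) (p : E → R) : R :=
  leafSum (fun q => (expect q F - expect p F) * (expect q G - expect p G)) t p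

omit [Fintype E] in
/-- `leafSum` at a leaf. -/
@[simp] lemma leafSum_leaf (φ : (E → R) → R) (p : E → R) : leafSum φ leaf p = φ p := rfl

omit [Fintype E] in
/-- `leafSum` at a node: the Bernoulli mixture of the two continuations. -/
lemma leafSum_node (φ : (E → R) → R) (e : E) (t0 t1 : DTree E) (p : E → R) :
    leafSum φ (node e t0 t1) p = p e * leafSum φ t1 (Function.update p e 1)
      + (1 - p e) * leafSum φ t0 (Function.update p e 0) := rfl

/-- `treeCov` at a leaf. -/
@[simp] lemma treeCov_leaf (F G : Config E → R) (p : E → R) : treeCov F G leaf p = 0 := rfl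

/-- `treeCov` at a node: the mixture of the two continuations plus the node term. -/
lemma treeCov_node (F G : Config E → R) (e : E) (t0 t1 : DTree E) (p : E → R) :
    treeCov F G (node e t0 t1) p = p e * treeCov F G t1 (Function.update p e 1)
      + (1 - p e) * treeCov F G t0 (Function.update p e 0)
      + p e * (1 - p e) * (expect (Function.update p e 1) F - expect (Function.update p e 0) F)
        * (expect (Function.update p e 1) G - expect (Function.update p e 0) G) := rfl

omit [Fintype E] in
/-- The leaf-sum of a constant functional is the constant (the leaf weights sum to one). -/
lemma leafSum_const (c : R) (t : DTree E) : ∀ p : E → R, leafSum (fun _ => c) t p = c := by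
  induction t with
  | leaf => intro p; rfl
  | node e t0 t1 ih0 ih1 => intro p; rw [leafSum_node, ih0, ih1]; ring

omit [Fintype E] in
/-- Leaf-sums are additive in the functional. -/
lemma leafSum_add (φ ψ : (E → R) → R) (t : DTree E) :
    ∀ p : E → R, leafSum (fun q => φ q + ψ q) t p = leafSum φ t p + leafSum ψ t p := by
  induction t with
  | leaf => intro p; rfl
  | node e t0 t1 ih0 ih1 => intro p; simp only [leafSum_node, ih0, ih1]; ring

omit [Fintype E] in
/-- Leaf-sums are homogeneous in the functional. -/
lemma leafSum_mul_const (c : R) (φ : (E → R) → R) (t : DTree E) :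
    ∀ p : E → R, leafSum (fun q => c * φ q) t p = c * leafSum φ t p := by
  induction t with
  | leaf => intro p; rfl
  | node e t0 t1 ih0 ih1 => intro p; simp only [leafSum_node, ih0, ih1]; ring

omit [Fintype E] in
/-- Leaf-sums respect subtraction of functionals. -/
lemma leafSum_sub (φ ψ : (E → R) → R) (t : DTree E) (p : E → R) :
    leafSum (fun q => φ q - ψ q) t p = leafSum φ t p - leafSum ψ t p := by
  have h := leafSum_add φ (fun q => (-1 : R) * ψ q) t p
  rw [leafSum_mul_const] at h
  simp only [sub_eq_add_neg, neg_one_mul] at h ⊢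
  exact h

/-- **Tower identity**: the leaf-sum of the conditional expectations is the expectation. -/
lemma leafSum_expect (F : Config E → R) (t : DTree E) :
    ∀ p : E → R, leafSum (fun q => expect q F) t p = expect p F := by
  induction t with
  | leaf => intro p; rfl
  | node e t0 t1 ih0 ih1 => intro p; rw [leafSum_node, ih0, ih1, expect_eq_pin p F e]

/-- **The law of total covariance along a decision tree** (an exact identity for every tree):
`Cov_p(F, G) = Σ_leaves P(leaf) · Cov_leaf(F, G) + treeCov F G t p`. -/
theorem cov_eq_leafSum_add_treeCov (F G : Config E → R) (t : DTree E) :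
    ∀ p : E → R, expect p (F * G) - expect p F * expect p G
      = leafSum (fun q => expect q (F * G) - expect q F * expect q G) t p + treeCov F G t p := by
  induction t with
  | leaf => intro p; simp [leafSum_leaf, treeCov_leaf]
  | node e t0 t1 ih0 ih1 =>
    intro p
    rw [leafSum_node, treeCov_node, expect_eq_pin p (F * G) e, expect_eq_pin p F e,
      expect_eq_pin p G e]
    have h1 := ih1 (Function.update p e 1)
    have h0 := ih0 (Function.update p e 0)
    linear_combination (p e) * h1 + (1 - p e) * h0

/-- The covariance of the leaf-conditional means is the tree covariance. -/
theorem condMeanCov_eq_treeCov (F G : Config E → R) (t : DTree E) (p : E → R) :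
    condMeanCov F G t p = treeCov F G t p := by
  unfold condMeanCov
  have hexp : ∀ q : E → R, (expect q F - expect p F) * (expect q G - expect p G)
      = (expect q (F * G) - (expect q (F * G) - expect q F * expect q G))
        - expect p G * expect q F - expect p F * expect q G + expect p F * expect p G := by
    intro q; ring
  simp only [hexp]
  rw [leafSum_add, leafSum_sub, leafSum_sub, leafSum_sub, leafSum_mul_const, leafSum_mul_const,
    leafSum_const, leafSum_expect, leafSum_expect, leafSum_expect]
  have h := cov_eq_leafSum_add_treeCov F G t p
  linear_combination h

section Order

variable [PartialOrder R] [IsOrderedRing R]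

/-- **(TREE-PA), tree form**: for admissible weights and monotone observables every node term of the
tree covariance is nonnegative, hence so is the tree covariance. -/
theorem treeCov_nonneg {F G : Config E → R} (hF : Monotone F) (hG : Monotone G) (t : DTree E) :
    ∀ p : E → R, IsProbVec p → 0 ≤ treeCov F G t p := by
  induction t with
  | leaf => intro p _; simp
  | node e t0 t1 ih0 ih1 =>
    intro p hp
    rw [treeCov_node]
    have ha0 : 0 ≤ p e := hp.nonneg e
    have ha1 : 0 ≤ 1 - p e := sub_nonneg.2 (hp.le_one e)
    have hp1 : IsProbVec (Function.update p e 1) := hp.update e zero_le_one le_rfl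
    have hp0 : IsProbVec (Function.update p e 0) := hp.update e le_rfl zero_le_one
    have hF' := expect_update_zero_le_expect_update_one hp hF e
    have hG' := expect_update_zero_le_expect_update_one hp hG e
    have h1 := ih1 (Function.update p e 1) hp1
    have h0 := ih0 (Function.update p e 0) hp0
    refine add_nonneg (add_nonneg (mul_nonneg ha0 h1) (mul_nonneg ha1 h0)) ?_
    exact mul_nonneg (mul_nonneg (mul_nonneg ha0 ha1) (sub_nonneg.2 hF')) (sub_nonneg.2 hG')

/-- **(TREE-PA)**: the conditional means of two monotone observables given the output of ANY
decision tree are positively correlated. -/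
theorem condMeanCov_nonneg {p : E → R} (hp : IsProbVec p) {F G : Config E → R} (hF : Monotone F)
    (hG : Monotone G) (t : DTree E) : 0 ≤ condMeanCov F G t p := by
  rw [condMeanCov_eq_treeCov]; exact treeCov_nonneg hF hG t p hp

/-- The covariance of monotone observables dominates the average leaf-conditional covariance of
any decision tree. -/
theorem leafSum_cov_le_cov {p : E → R} (hp : IsProbVec p) {F G : Config E → R} (hF : Monotone F)
    (hG : Monotone G) (t : DTree E) :
    leafSum (fun q => expect q (F * G) - expect q F * expect q G) t p
      ≤ expect p (F * G) - expect p F * expect p G := by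
  have hT := treeCov_nonneg hF hG t p hp
  rw [cov_eq_leafSum_add_treeCov F G t p]
  exact le_add_of_nonneg_right hT

end Order

end DTree

end Summit.Ventures.PercRepro2
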